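import Summits.PneNP.PneNP.Theorems.ChebyshevTracialDesignVirtualLayerFunctional
import HarnessLib

/-!
# Cell pnp-psdrank, route `ChebyshevTracialDesign`: the virtual/tight LAYER RATIO — Grigoriev's virtual functional is the normalised
# tight functional times `1 + ρ_{2κ} ∈ [1, 2^κ]`

Harmonic backbone of the crux `TracialDecayExp20` (stmt-PneNP-19878), brick 44b (prover g10; companion of `…VirtualLayerFunctional`).
For `n` even, `t = 2a+1` with `2t ≤ n`, a perfect matching `M` of `K_n` and a harmonic `p` of degree `2κ` (`κ ≤ a`, `4κ ≤ n`), brick 44a gives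
`Ẽ_M[ζp] = V_κ · Π_p(M)` with `V_κ = Π_{i<κ}(2a+1−2i)/(n−2i)·Π_{i<κ}(n−2a−1−2i)/(n−2κ−2i)`, and the tree's tight column sum is
`Σ_{|U|=t, cc(U,M)=1} ζp(U) = B^t_κ · Π_p(M)`, `B^t_κ = (n−2a−2κ)·C(n/2−2κ, a−κ)` (`…TightColumnSums.tight_column_sum_eq_of_even`). HERE:
* §4 `tightScalar_mul_prod_eq` — the tight scalar in product form: `B^t_κ · Π_{i<2κ}(n−2i) = N₁ · Π_{i<κ}(2a−2i)(n−2a−2−2i)`,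
  `N₁ = C(n/2,a+1)·C(a+1,a)·2 = #{U : |U| = t, cc(U,M) = 1}` (induction on `κ` through `C(N,K)K(N−K) = N(N−1)C(N−2,K−1)`);
* §5 **`virtualScalar_mul_eq_ratio_mul_tightScalar`**, **`virtualSum_mul_eq_ratio_mul_tightSum`**, `one_le_layerRatio`, `layerRatio_le_two_pow` —
  `V_κ · N₁ = R_κ · B^t_κ`, i.e. `Ẽ_M[ζp] = R_κ · E_{U tight for M}[ζp(U)]` for EVERY harmonic `p` of degree `2κ`, with the LAYER RATIO
  `R_κ = Π_{i<κ} (2a+1−2i)(n−2a−1−2i)/((2a−2i)(n−2a−2−2i)) = 1 + ρ_{2κ} ∈ [1, 2^κ]` (`κ < a`; in the cell's regime `κ ≤ dq n ≪ n`,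
  `ρ_{2κ} ≈ 4κ/n`: `ρ₂ = t(n−t)/((t−1)(n−t−1)) − 1`, and planner p1's numerics `ρ₂ = 0.052, ρ₄ = 0.110` at `n = 80` ARE this formula).
So the virtual level is the tight level re-weighted mode by mode by `1 + ρ_{2κ}` — MEMO-12 §2(d)'s `ε_κ`, now a closed form; with the tight
layer correlations `T_{2κ}` of bricks 25–28 this turns SNT's head estimate into a VIRTUAL-NONNEGATIVITY estimate for spread cells (next file).
[cite: Grigoriev2001, Lemma 1.4 (PDF p. 8)] [cite: Rothvoss2017, §2 (PDF p. 6)] [cite: GodsilMeagher2015, §15.2 (perfect matching scheme)]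
Stature: support/instrument (no defs). WHAT THIS IS NOT: not virtual nonnegativity, nothing on psd rank, no P-vs-NP content. Supports stmt-PneNP-19878.
-/

set_option linter.dupNamespace false -- `Summit.PneNP.PneNP.…`: summit = sub-problem (D-0017)

noncomputable section

namespace Summit.PneNP.PneNP.Theorems.ChebyshevTracialDesignVirtualLayerRatio

open Finset Literature.Barriers.PneNP Literature.Computability.Complexity
open Literature.Combinatorics.SimpleGraph.CycleSpace
open Literature.Combinatorics.AssociationSchemes Literature.Combinatorics.AssociationSchemes.JohnsonHarmonics
open Summit.PneNP.PneNP.Theorems.ChebyshevTracialDesignTightColumnSums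
open Summit.PneNP.PneNP.Theorems.ChebyshevTracialDesignJunta (two_mul_card_eq)
open Summit.PneNP.PneNP.Theorems.ChebyshevTracialDesignVirtualLayerFunctional

variable {n : ℕ}

/-! ### §4 The tight scalar in product form -/

/-- The binomial identity `C(N,K)·K·(N−K) = N(N−1)·C(N−2,K−1)` (`1 ≤ K`, `K + 1 ≤ N`). [folklore] -/
theorem choose_mul_mul_eq {N K : ℕ} (hK : 1 ≤ K) (hN : K + 1 ≤ N) :
    N.choose K * K * (N - K) = N * (N - 1) * (N - 2).choose (K - 1) := by
  obtain ⟨N', rfl⟩ : ∃ N', N = N' + 2 := ⟨N - 2, by omega⟩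
  obtain ⟨K', rfl⟩ : ∃ K', K = K' + 1 := ⟨K - 1, by omega⟩
  have h1 : (N' + 2).choose (K' + 1) * (K' + 1) = (N' + 2) * (N' + 1).choose K' :=
    (Nat.add_one_mul_choose_eq (N' + 1) K').symm
  have h2 : (N' + 1).choose K' * (N' + 1 - K') = N'.choose K' * (N' + 1) :=
    (Nat.choose_mul_succ_eq N' K').symm
  have e1 : N' + 2 - (K' + 1) = N' + 1 - K' := by omega
  have e2 : N' + 2 - 1 = N' + 1 := by omega
  have e3 : N' + 2 - 2 = N' := by omega
  have e4 : K' + 1 - 1 = K' := by omega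
  rw [e1, e2, e3, e4, h1, mul_assoc, h2]
  ring

/-- **The tight scalar in product form.** For `n` even, `t = 2a+1` with `2t ≤ n` and `κ ≤ a`, the scalar of the tree's tight column sum
(`…TightColumnSums.tight_column_sum_eq_of_even`) satisfies
`(n − 2a − 2κ)·C(n/2 − 2κ, a − κ)·Π_{i<2κ}(n − 2i) = N₁·Π_{i<κ}(2a − 2i)(n − 2a − 2 − 2i)`, `N₁ = C(n/2, a+1)·C(a+1, a)·2` the number of
tight `t`-cuts of a perfect matching. [cite: Rothvoss2017, §2 (PDF p. 6)] [cite: GodsilMeagher2015, §15.2] -/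
theorem tightScalar_mul_prod_eq {a : ℕ} (hn : Even n) (ht : 2 * (2 * a + 1) ≤ n) :
    ∀ κ : ℕ, κ ≤ a →
      ((n : ℝ) - (2 * a : ℕ) - (2 * κ : ℕ)) * ((((n / 2 - 2 * κ).choose (a - κ) : ℕ) : ℝ)) *
          ∏ i ∈ range (2 * κ), ((n : ℝ) - 2 * i) =
        ((((n / 2).choose (1 + a) * (1 + a).choose a * 2 ^ 1 : ℕ) : ℝ)) *
          ∏ i ∈ range κ, (((2 * a : ℝ) - 2 * i) * ((n : ℝ) - 2 * a - 2 - 2 * i)) := by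
  obtain ⟨m, hm⟩ := hn
  have hm2 : n / 2 = m := by omega
  have hnm : (n : ℝ) = 2 * m := by
    have h : (n : ℝ) = m + m := by exact_mod_cast hm
    rw [h]; ring
  have ham : a + 1 ≤ m := by omega
  rw [hm2]
  intro κ
  induction κ with
  | zero =>
    intro _
    simp only [Nat.mul_zero, Nat.cast_zero, sub_zero, Nat.sub_zero, range_zero, prod_empty, mul_one]
    have h1 : (1 + a).choose a = a + 1 := by rw [add_comm]; exact Nat.choose_succ_self_right a
    have h2 : m.choose (a + 1) * (a + 1) = m.choose a * (m - a) := Nat.choose_succ_right_eq m a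
    rw [h1, show 1 + a = a + 1 by ring]
    have h2R : (m.choose (a + 1) : ℝ) * (a + 1) = (m.choose a : ℝ) * ((m : ℝ) - a) := by
      have := congrArg (fun z : ℕ => (z : ℝ)) h2
      push_cast [Nat.cast_sub (by omega : a ≤ m)] at this
      exact this
    push_cast
    rw [hnm]
    linear_combination (-2 : ℝ) * h2R
  | succ κ ih =>
    intro hκa
    have ih' := ih (by omega)
    -- the binomial step with `N = m − 2κ`, `K = a − κ`
    have hbin := choose_mul_mul_eq (N := m - 2 * κ) (K := a - κ) (by omega) (by omega)
    have e1 : m - 2 * (κ + 1) = m - 2 * κ - 2 := by omega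
    have e2 : a - (κ + 1) = a - κ - 1 := by omega
    rw [e1, e2]
    have hbinR : (((m - 2 * κ).choose (a - κ) : ℕ) : ℝ) * ((a : ℝ) - κ) * ((m : ℝ) - a - κ) =
        ((m : ℝ) - 2 * κ) * ((m : ℝ) - 2 * κ - 1) * (((m - 2 * κ - 2).choose (a - κ - 1) : ℕ) : ℝ) := by
      have := congrArg (fun z : ℕ => (z : ℝ)) hbin
      push_cast [Nat.cast_sub (show κ ≤ a by omega), Nat.cast_sub (show 2 * κ ≤ m by omega),
        Nat.cast_sub (show a - κ ≤ m - 2 * κ by omega), Nat.cast_sub (show 1 ≤ m - 2 * κ by omega)] at this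
      linear_combination this
    -- expand the products by one step
    have hprodL : ∏ i ∈ range (2 * (κ + 1)), ((n : ℝ) - 2 * i) =
        (∏ i ∈ range (2 * κ), ((n : ℝ) - 2 * i)) * ((n : ℝ) - 2 * ((2 * κ : ℕ) : ℝ)) *
          ((n : ℝ) - 2 * ((2 * κ + 1 : ℕ) : ℝ)) := by
      rw [show 2 * (κ + 1) = 2 * κ + 1 + 1 by ring, prod_range_succ, prod_range_succ]
    rw [hprodL, prod_range_succ]
    -- multiply the induction hypothesis by the new factor and compare
    have hfac : ((n : ℝ) - 2 * ((2 * κ : ℕ) : ℝ)) * ((n : ℝ) - 2 * ((2 * κ + 1 : ℕ) : ℝ)) =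
        4 * (((m : ℝ) - 2 * κ) * ((m : ℝ) - 2 * κ - 1)) := by push_cast; rw [hnm]; ring
    -- target: LHS_{κ+1} = (2a − 2κ)(n − 2a − 2 − 2κ) · LHS_κ (using `ih'`)
    have key : ((n : ℝ) - (2 * a : ℕ) - (2 * (κ + 1) : ℕ)) * ((((m - 2 * κ - 2).choose (a - κ - 1) : ℕ) : ℝ)) *
        ((∏ i ∈ range (2 * κ), ((n : ℝ) - 2 * i)) * ((n : ℝ) - 2 * ((2 * κ : ℕ) : ℝ)) *
          ((n : ℝ) - 2 * ((2 * κ + 1 : ℕ) : ℝ))) =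
        (((2 * a : ℝ) - 2 * κ) * ((n : ℝ) - 2 * a - 2 - 2 * κ)) *
          (((n : ℝ) - (2 * a : ℕ) - (2 * κ : ℕ)) * ((((m - 2 * κ).choose (a - κ) : ℕ) : ℝ)) *
            ∏ i ∈ range (2 * κ), ((n : ℝ) - 2 * i)) := by
      have hne : (n : ℝ) - (2 * a : ℕ) - (2 * κ : ℕ) ≠ 0 := by
        push_cast; rw [hnm]
        have : ((a : ℝ) + κ) + 1 ≤ m := by exact_mod_cast (show a + κ + 1 ≤ m by omega)
        linarith
      -- `(n−2a−2κ−2)·C' ·4(m−2κ)(m−2κ−1) = (2a−2κ)(n−2a−2−2κ)(n−2a−2κ)·C` where `C·(a−κ)(m−a−κ) = (m−2κ)(m−2κ−1)·C'`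
      rw [mul_assoc (∏ i ∈ range (2 * κ), ((n : ℝ) - 2 * i)), hfac]
      push_cast at hbinR hne ⊢
      rw [hnm] at hne ⊢
      -- both sides are multiples of the product; reduce to scalars
      have hsc : (2 * (m : ℝ) - 2 * a - 2 * (κ + 1)) * (((m - 2 * κ - 2).choose (a - κ - 1) : ℕ) : ℝ) *
          (4 * (((m : ℝ) - 2 * κ) * ((m : ℝ) - 2 * κ - 1))) =
          ((2 * a : ℝ) - 2 * κ) * (2 * (m : ℝ) - 2 * a - 2 - 2 * κ) *
            ((2 * (m : ℝ) - 2 * a - 2 * κ) * (((m - 2 * κ).choose (a - κ) : ℕ) : ℝ)) := by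
        linear_combination (4 * (2 * (m : ℝ) - 2 * a - 2 * (κ + 1))) * hbinR.symm
      linear_combination (∏ i ∈ range (2 * κ), ((2 * (m : ℝ)) - 2 * i)) * hsc
    rw [key, ih']
    push_cast
    ring

/-! ### §5 The virtual scalar is the normalised tight scalar times `1 + ρ_{2κ} ∈ [1, 2^κ]` -/

/-- **`V_κ · N₁ = R_κ · B^t_κ`**: for `n` even, `t = 2a+1`, `2t ≤ n`, `κ ≤ a`, `4κ ≤ n`, with the virtual scalar
`V_κ = Π_{i<κ}(2a+1−2i)/(n−2i)·Π_{i<κ}(n−2a−1−2i)/(n−2κ−2i)`, the tight scalar `B^t_κ = (n−2a−2κ)·C(n/2−2κ, a−κ)`, the tight-cut count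
`N₁ = C(n/2,a+1)·C(a+1,a)·2` and the LAYER RATIO `R_κ = Π_{i<κ} (2a+1−2i)(n−2a−1−2i)/((2a−2i)(n−2a−2−2i)) = 1 + ρ_{2κ}`.
[cite: Grigoriev2001, Lemma 1.4 (PDF p. 8)] [cite: Rothvoss2017, §2 (PDF p. 6)] -/
theorem virtualScalar_mul_eq_ratio_mul_tightScalar {a κ : ℕ} (hn : Even n) (ht : 2 * (2 * a + 1) ≤ n) (hκa : κ ≤ a)
    (hκn : 4 * κ ≤ n) :
    ((∏ i ∈ range κ, (((2 * a + 1 : ℝ) - 2 * i) / ((n : ℝ) - 2 * i))) *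
        ∏ i ∈ range κ, (((n : ℝ) - 2 * a - 1 - 2 * i) / ((n : ℝ) - 2 * κ - 2 * i))) *
        ((((n / 2).choose (1 + a) * (1 + a).choose a * 2 ^ 1 : ℕ) : ℝ)) =
      (∏ i ∈ range κ, (((2 * a + 1 : ℝ) - 2 * i) * ((n : ℝ) - 2 * a - 1 - 2 * i) /
          (((2 * a : ℝ) - 2 * i) * ((n : ℝ) - 2 * a - 2 - 2 * i)))) *
        (((n : ℝ) - (2 * a : ℕ) - (2 * κ : ℕ)) * ((((n / 2 - 2 * κ).choose (a - κ) : ℕ) : ℝ))) := by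
  have htight := tightScalar_mul_prod_eq hn ht κ hκa
  -- `Π_{i<2κ}(n−2i) = Π_{i<κ}(n−2i) · Π_{i<κ}(n−2κ−2i)`, nonzero
  have hsplit : ∏ i ∈ range (2 * κ), ((n : ℝ) - 2 * i) =
      (∏ i ∈ range κ, ((n : ℝ) - 2 * i)) * ∏ i ∈ range κ, ((n : ℝ) - 2 * κ - 2 * i) := by
    rw [two_mul, prod_range_add]
    congr 1
    exact prod_congr rfl fun i _ => by push_cast; ring
  have hP1 : ∏ i ∈ range κ, ((n : ℝ) - 2 * i) ≠ 0 := by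
    refine prod_ne_zero_iff.2 fun i hi => ?_
    have := mem_range.1 hi
    have : (2 * i : ℝ) < n := by exact_mod_cast (show 2 * i < n by omega)
    linarith
  have hP2 : ∏ i ∈ range κ, ((n : ℝ) - 2 * κ - 2 * i) ≠ 0 := by
    refine prod_ne_zero_iff.2 fun i hi => ?_
    have := mem_range.1 hi
    have : (2 * κ + 2 * i : ℝ) < n := by exact_mod_cast (show 2 * κ + 2 * i < n by omega)
    linarith
  have hB : ∏ i ∈ range κ, (((2 * a : ℝ) - 2 * i) * ((n : ℝ) - 2 * a - 2 - 2 * i)) ≠ 0 := by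
    refine prod_ne_zero_iff.2 fun i hi => mul_ne_zero ?_ ?_
    · have := mem_range.1 hi
      have : (2 * i : ℝ) < 2 * a := by exact_mod_cast (show 2 * i < 2 * a by omega)
      linarith
    · have := mem_range.1 hi
      have : (2 * a + 2 + 2 * i : ℝ) < n := by exact_mod_cast (show 2 * a + 2 + 2 * i < n by omega)
      linarith
  -- rewrite everything over the common denominator `Π_{i<2κ}(n−2i)`
  rw [hsplit] at htight
  rw [prod_div_distrib, prod_div_distrib, prod_div_distrib]
  rw [div_mul_div_comm, div_mul_eq_mul_div, div_mul_eq_mul_div, div_eq_div_iff (mul_ne_zero hP1 hP2) hB]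
  -- `A · N₁ · B = A' · (B^t · (P1 P2))`-type identity from `htight`
  have hA : ∏ i ∈ range κ, (((2 * a + 1 : ℝ) - 2 * i) * ((n : ℝ) - 2 * a - 1 - 2 * i)) =
      (∏ i ∈ range κ, ((2 * a + 1 : ℝ) - 2 * i)) * ∏ i ∈ range κ, ((n : ℝ) - 2 * a - 1 - 2 * i) :=
    prod_mul_distrib
  rw [hA]
  linear_combination ((∏ i ∈ range κ, ((2 * a + 1 : ℝ) - 2 * i)) * ∏ i ∈ range κ, ((n : ℝ) - 2 * a - 1 - 2 * i)) * htight.symm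

/-- **`1 ≤ R_κ`**: the layer ratio is at least one (`κ ≤ a`, `2(2a+1) ≤ n`). [cite: Grigoriev2001, Lemma 1.4 (PDF p. 8)] -/
theorem one_le_layerRatio {a κ : ℕ} (ht : 2 * (2 * a + 1) ≤ n) (hκa : κ ≤ a) :
    1 ≤ ∏ i ∈ range κ, (((2 * a + 1 : ℝ) - 2 * i) * ((n : ℝ) - 2 * a - 1 - 2 * i) /
        (((2 * a : ℝ) - 2 * i) * ((n : ℝ) - 2 * a - 2 - 2 * i))) := by
  calc (1 : ℝ) = ∏ _i ∈ range κ, (1 : ℝ) := prod_const_one.symm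
    _ ≤ _ := prod_le_prod (fun _ _ => zero_le_one) fun i hi => ?_
  have hi' := mem_range.1 hi
  have hx : (0 : ℝ) < (2 * a : ℝ) - 2 * i := by
    have : (2 * i : ℝ) < 2 * a := by exact_mod_cast (show 2 * i < 2 * a by omega)
    linarith
  have hy : (0 : ℝ) < (n : ℝ) - 2 * a - 2 - 2 * i := by
    have : (2 * a + 2 + 2 * i : ℝ) < n := by exact_mod_cast (show 2 * a + 2 + 2 * i < n by omega)
    linarith
  rw [le_div_iff₀ (mul_pos hx hy), one_mul]
  nlinarith

/-- **`R_κ ≤ 2^κ`**: each factor of the layer ratio is `(1 + 1/x)(1 + 1/y) ≤ 2` with `x, y ≥ 4` (`κ < a`, `2(2a+1) ≤ n`); in the cell's regime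
`κ ≤ dq n ≪ a` the ratio is `1 + O(κ/n)`. [cite: Grigoriev2001, Lemma 1.4 (PDF p. 8)] -/
theorem layerRatio_le_two_pow {a κ : ℕ} (ht : 2 * (2 * a + 1) ≤ n) (hκa : κ + 1 ≤ a) :
    ∏ i ∈ range κ, (((2 * a + 1 : ℝ) - 2 * i) * ((n : ℝ) - 2 * a - 1 - 2 * i) /
        (((2 * a : ℝ) - 2 * i) * ((n : ℝ) - 2 * a - 2 - 2 * i))) ≤ (2 : ℝ) ^ κ := by
  rw [show (2 : ℝ) ^ κ = ∏ _i ∈ range κ, (2 : ℝ) by simp]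
  refine prod_le_prod (fun i hi => ?_) fun i hi => ?_
  · have hi' := mem_range.1 hi
    have hx : (0 : ℝ) < (2 * a : ℝ) - 2 * i := by
      have : (2 * i : ℝ) < 2 * a := by exact_mod_cast (show 2 * i < 2 * a by omega)
      linarith
    have hy : (0 : ℝ) < (n : ℝ) - 2 * a - 2 - 2 * i := by
      have : (2 * a + 2 + 2 * i : ℝ) < n := by exact_mod_cast (show 2 * a + 2 + 2 * i < n by omega)
      linarith
    exact div_nonneg (mul_nonneg (by linarith) (by linarith)) (mul_pos hx hy).le
  · have hi' := mem_range.1 hi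
    have hx : (4 : ℝ) ≤ (2 * a : ℝ) - 2 * i := by
      have : (2 * i + 4 : ℝ) ≤ 2 * a := by exact_mod_cast (show 2 * i + 4 ≤ 2 * a by omega)
      linarith
    have hy : (4 : ℝ) ≤ (n : ℝ) - 2 * a - 2 - 2 * i := by
      have : (2 * a + 2 + 2 * i + 4 : ℝ) ≤ n := by exact_mod_cast (show 2 * a + 2 + 2 * i + 4 ≤ n by omega)
      linarith
    rw [div_le_iff₀ (by positivity)]
    nlinarith

/-- **Grigoriev's virtual functional is the normalised tight functional times `R_κ`.** For `n` even, `t = 2a+1` with `2t ≤ n`,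
`κ ≤ a`, `4κ ≤ n`, every perfect matching `M` of `K_n` and every harmonic `p` of degree `2κ`:
`(Σ_A p_A · knapsackMoment(|M|, t/2, x_M(A))) · N₁ = R_κ · Σ_{|U| = t, cc(U,M) = 1} ζp(U)` — with `N₁ = |{U : |U| = t, cc(U,M) = 1}|`,
i.e. `Ẽ_M[ζp] = R_κ · E_{U tight for M}[ζp(U)]`, `R_κ = 1 + ρ_{2κ} ∈ [1, 2^κ]`. [cite: Grigoriev2001, Lemma 1.4 (PDF p. 8)]
[cite: Rothvoss2017, §2 (PDF p. 6)] [cite: GodsilMeagher2015, §15.2 (perfect matching scheme)] -/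
theorem virtualSum_mul_eq_ratio_mul_tightSum {a κ : ℕ} (hn : Even n) (ht : 2 * (2 * a + 1) ≤ n) (hκa : κ ≤ a)
    (hκn : 4 * κ ≤ n) (M : PMatch n) {p : Finset (Fin n) → ℝ} (hp : IsHarmonic (2 * κ) p) :
    (∑ A : Finset (Fin n), p A *
        knapsackMoment M.1.card (((2 * a + 1 : ℕ) : ℝ) / 2) (M.1.filter fun e => ∃ x ∈ A, x ∈ e).card) *
        ((((n / 2).choose (1 + a) * (1 + a).choose a * 2 ^ 1 : ℕ) : ℝ)) =
      (∏ i ∈ range κ, (((2 * a + 1 : ℝ) - 2 * i) * ((n : ℝ) - 2 * a - 1 - 2 * i) /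
          (((2 * a : ℝ) - 2 * i) * ((n : ℝ) - 2 * a - 2 - 2 * i)))) *
        ∑ U ∈ univ.filter (fun U : OddSet n => U.1.card = 2 * a + 1 ∧ cc U M = 1), zeta p U.1 := by
  have hN : M.1.card = n / 2 := by
    have h := two_mul_card_eq M.2
    rw [card_univ, Fintype.card_fin] at h
    omega
  rw [virtualSum_eq_of_even M (by omega) hp, hN, altSum_knapsackMoment_eq (n / 2) κ _ (by omega),
    virtualScalar_eq_prod hn hκn, tight_column_sum_eq_of_even M hκn hκa hp]
  have h := virtualScalar_mul_eq_ratio_mul_tightScalar hn ht hκa hκn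
  calc _ = ((∏ i ∈ range κ, (((2 * a + 1 : ℝ) - 2 * i) / ((n : ℝ) - 2 * i))) *
        ∏ i ∈ range κ, (((n : ℝ) - 2 * a - 1 - 2 * i) / ((n : ℝ) - 2 * κ - 2 * i))) *
        ((((n / 2).choose (1 + a) * (1 + a).choose a * 2 ^ 1 : ℕ) : ℝ)) *
        ∑ T ∈ univ.filter (fun T : Finset (Fin n) => (T.filter fun x => M.2.partner x ∈ T).card = 2 * κ), p T := by ring
    _ = _ := by rw [h]; ring

end Summit.PneNP.PneNP.Theorems.ChebyshevTracialDesignVirtualLayerRatio
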